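import Mathlib

/-!
# Venture HSemireg — W3 SPECIAL FIBRES, Jacobian centres: the K-adapted homology frame of the trigonal-cyclic
# Jacobians is ζ-decomposed into identical 4 × 4 blocks (seat `w3-jac-1` g3, file of record
# `widen/W3/W3-JAC-1-ZBLOCK.md` v1.1; companion `widen/W3/prym2/g3/CONORMAL-X2.md` §5quater–§5decies of seat `w3-prym-2`)

HONEST FRAMING. Lean index of the computation cell `pub-hsemireg`, widening seat `w3-jac-1`.  ELEMENTARY INTEGER
LINEAR ALGEBRA OF ONE EXPLICIT 4 × 4 MATRIX AND ITS BLOCK-DIAGONAL SUMS ONLY: no curve, no Jacobian, no theta function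
and no semiregularity map is constructed here.  On paper (ZBLOCK §2, pencil; machine-exact for every even genus ≤ 40)
the deck transformation ζ of the curve v³ = ∏ (x − p_j)^{(1,2,…)} acts, in the K-adapted symplectic frame of record,
as the block-diagonal sum of `p = g/2` copies of the matrix `Z0` below on the coordinate groups
(a′_{2m}, a′_{2m+1}, b′_{2m}, b′_{2m+1}); the statements proved here are the block facts from which the frame
congruences (m1)/(m2), the cyclotomic relation 1 + ζ + ζ² = 0, symplecticity, the multiplier-3 similitude
η = ζ_std − 1 and the integral symplectic M′ = η · diag(3,3,1,1)⁻¹ follow for EVERY `p` at once.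
Nothing here says that HC, HC_CM or HC_AV holds, or that any object is semiregular.

CONTENT (all PROVED, 0 sorry), namespace `Summit.Ventures.HSemireg.JacFrame`:
* `Z0`, `J4`, `zetaStd`, `eta`, `Mprime` — the block matrices (rows = images convention for `Z0`; `zetaStd` is the
  block `[[D₀, C₀],[B₀, A₀]]` acting by the textbook rule);
* `Z0_cube`, `Z0_cyclotomic`, `Z0_symplectic` — `Z0³ = 1`, `Z0² + Z0 + 1 = 0`, `Z0 · J4 · Z0ᵀ = J4`;
* `zetaStd_symplectic`, `zetaStd_cyclotomic`, `zetaStd_m1`, `zetaStd_m2` — `ζ_stdᵀ J ζ_std = J`, `ζ_std² + ζ_std + 1 = 0`,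
  the congruences (m1) `A ≡ D ≡ I, C ≡ 0, B ≡ 2·swap (mod 3)` entrywise, and (m2) `diag(C Dᵀ) = diag(A Bᵀ) = 0`;
* `eta_similitude`, `Mprime_symplectic`, `eta_eq` — `ηᵀ J η = 3 J`, `M′ᵀ J M′ = J`, `η = M′ · diag(3,3,1,1)`;
* `zetaBlocks_cube`, `zetaBlocks_cyclotomic`, `zetaBlocks_symplectic` — the same three identities for the
  block-diagonal sum of `p` copies, for every `p : ℕ`.
-/

namespace Summit.Ventures.HSemireg

namespace JacFrame

open Matrix

/-- The 4 × 4 block of the deck transformation ζ in the K-adapted frame (rows = images of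
a′_{2m}, a′_{2m+1}, b′_{2m}, b′_{2m+1}); ZBLOCK §1. -/
def Z0 : Matrix (Fin 4) (Fin 4) ℤ := !![1, 0, 0, 3; 0, 1, 3, 0; 0, -1, -2, 0; -1, 0, 0, -2]

/-- The standard symplectic form on one block, coordinates (a′_{2m}, a′_{2m+1} | b′_{2m}, b′_{2m+1}). -/
def J4 : Matrix (Fin 4) (Fin 4) ℤ := !![0, 0, 1, 0; 0, 0, 0, 1; -1, 0, 0, 0; 0, -1, 0, 0]

/-- The block `[[D₀, C₀],[B₀, A₀]] = [[−2I, −swap],[3·swap, I]]` of ζ in the textbook convention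
τ ↦ (Aτ + B)(Cτ + D)⁻¹ (seat w3-prym-2's `ζ_std`); ZBLOCK §3. -/
def zetaStd : Matrix (Fin 4) (Fin 4) ℤ := !![-2, 0, 0, -1; 0, -2, -1, 0; 0, 3, 1, 0; 3, 0, 0, 1]

/-- The multiplier-3 similitude block `η = ζ_std − 1`. -/
def eta : Matrix (Fin 4) (Fin 4) ℤ := !![-3, 0, 0, -1; 0, -3, -1, 0; 0, 3, 0, 0; 3, 0, 0, 0]

/-- The integral symplectic block `M′ = η · diag(3,3,1,1)⁻¹`. -/
def Mprime : Matrix (Fin 4) (Fin 4) ℤ := !![-1, 0, 0, -1; 0, -1, -1, 0; 0, 1, 0, 0; 1, 0, 0, 0]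

/-- The diagonal matrix diag(3,3,1,1) (the multiplier-3 elementary divisor shape on one block). -/
def D31 : Matrix (Fin 4) (Fin 4) ℤ := !![3, 0, 0, 0; 0, 3, 0, 0; 0, 0, 1, 0; 0, 0, 0, 1]

/-- `Z0³ = 1`: the block has order 3. -/
theorem Z0_cube : Z0 ^ 3 = 1 := by decide

/-- `1 + Z0 + Z0² = 0`: the cyclotomic relation (= `π*π_* = 0`, the quotient curve being ℙ¹). -/
theorem Z0_cyclotomic : Z0 ^ 2 + Z0 + 1 = 0 := by decide

/-- `Z0 · J4 · Z0ᵀ = J4`: the block preserves the symplectic form (rows = images convention). -/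
theorem Z0_symplectic : Z0 * J4 * Z0ᵀ = J4 := by decide

/-- `ζ_stdᵀ · J4 · ζ_std = J4`: the textbook-convention block is symplectic. -/
theorem zetaStd_symplectic : zetaStdᵀ * J4 * zetaStd = J4 := by decide

/-- `ζ_std² + ζ_std + 1 = 0`. -/
theorem zetaStd_cyclotomic : zetaStd ^ 2 + zetaStd + 1 = 0 := by decide

/-- `η = ζ_std − 1` (definition check). -/
theorem eta_eq_sub : eta = zetaStd - 1 := by decide

/-- `ηᵀ J η = 3 J`: η is a symplectic similitude of multiplier 3 on the block. -/
theorem eta_similitude : etaᵀ * J4 * eta = 3 • J4 := by decide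

/-- `η = M′ · diag(3,3,1,1)`, i.e. `M′ = η · diag(3,3,1,1)⁻¹` is integral. -/
theorem eta_eq : eta = Mprime * D31 := by decide

/-- `M′ᵀ · J4 · M′ = J4`: `M′ = η · diag(3,3,1,1)⁻¹` is integral AND symplectic. -/
theorem Mprime_symplectic : Mprimeᵀ * J4 * Mprime = J4 := by decide

/-- (m1): with `ζ_std = [[A, B],[C, D]]` in 2 × 2 blocks, `A ≡ D ≡ I`, `C ≡ 0`, `B ≡ 2·swap (mod 3)`,
stated entrywise on the 4 × 4 block as an equality of matrices over `ZMod 3`. -/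
theorem zetaStd_m1 :
    zetaStd.map (Int.castRingHom (ZMod 3)) = !![1, 0, 0, 2; 0, 1, 2, 0; 0, 0, 1, 0; 0, 0, 0, 1] := by decide

/-- (m2): the half-diagonal vectors `diag(C Dᵀ)` and `diag(A Bᵀ)` of `ζ_std = [[A,B],[C,D]]` VANISH
(`A = [[−2,0],[0,−2]]`, `B = [[0,−1],[−1,0]]`, `C = [[0,3],[3,0]]`, `D = I`), so the affine action of `ζ_std` on
theta characteristics fixes `(0; 0)` exactly. -/
theorem zetaStd_m2 :
    (fun i : Fin 2 => ∑ k : Fin 2, zetaStd (Fin.natAdd 2 i) (Fin.castAdd 2 k) * zetaStd (Fin.natAdd 2 i) (Fin.natAdd 2 k))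
        = 0 ∧
    (fun i : Fin 2 => ∑ k : Fin 2, zetaStd (Fin.castAdd 2 i) (Fin.castAdd 2 k) * zetaStd (Fin.castAdd 2 i) (Fin.natAdd 2 k))
        = 0 := by
  constructor <;> decide

/-- The block-diagonal sum of `p` copies of `Z0` (the matrix of ζ in the full K-adapted frame of genus `g = 2p`). -/
def zetaBlocks (p : ℕ) : Matrix (Fin 4 × Fin p) (Fin 4 × Fin p) ℤ := blockDiagonal fun _ => Z0

/-- The block-diagonal symplectic form of the full frame. -/
def Jblocks (p : ℕ) : Matrix (Fin 4 × Fin p) (Fin 4 × Fin p) ℤ := blockDiagonal fun _ => J4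

/-- For every `p`: the block-diagonal sum of `p` copies of `Z0` has cube `1`. -/
theorem zetaBlocks_cube (p : ℕ) : zetaBlocks p ^ 3 = 1 := by
  have h : zetaBlocks p = Matrix.blockDiagonalRingHom (Fin 4) (Fin p) ℤ (fun _ => Z0) := rfl
  rw [h, ← map_pow]
  have h3 : (fun _ : Fin p => Z0) ^ 3 = 1 := by
    funext k; simp [Z0_cube]
  rw [h3, map_one]

/-- For every `p`: `1 + Z + Z² = 0` for the block-diagonal sum `Z` of `p` copies of `Z0`. -/
theorem zetaBlocks_cyclotomic (p : ℕ) : zetaBlocks p ^ 2 + zetaBlocks p + 1 = 0 := by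
  have h : zetaBlocks p = Matrix.blockDiagonalRingHom (Fin 4) (Fin p) ℤ (fun _ => Z0) := rfl
  rw [h, ← map_pow, ← map_add, ← map_one (Matrix.blockDiagonalRingHom (Fin 4) (Fin p) ℤ), ← map_add]
  have h2 : (fun _ : Fin p => Z0) ^ 2 + (fun _ : Fin p => Z0) + 1 = 0 := by
    funext k; simp [Z0_cyclotomic]
  rw [h2, map_zero]

/-- For every `p`: the block-diagonal sum of `p` copies of `Z0` preserves the block-diagonal symplectic form. -/
theorem zetaBlocks_symplectic (p : ℕ) : zetaBlocks p * Jblocks p * (zetaBlocks p)ᵀ = Jblocks p := by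
  simp only [zetaBlocks, Jblocks, blockDiagonal_transpose, ← blockDiagonal_mul, Z0_symplectic]

end JacFrame

end Summit.Ventures.HSemireg
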